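import Summits.AtomisticToContinuum.Crystallization.Theorems.PalmUnimodularRigidityLayeredLawsSelectHcpDefs
import Mathlib.Analysis.Calculus.Deriv.MeanValue
import Mathlib.Analysis.Calculus.Deriv.Inv
import Mathlib.Analysis.Calculus.Deriv.Pow

/-!
# The quadratic lower model of the concave cable well
(stub `tube_cableLowerModel` of line `mtp-prestress-split-ergodic-frame`,
crux `LayeredLawsSelectHcp`, stmt-AtomisticToContinuum-9226)

In the squared-length variable the Lennard-Jones well is `W(s) = V_LJ(√s) = s⁻⁶/12 − s⁻³/6`
(`cable_lennardJones_sqrt`), with `W′ = ljSqDeriv = ½(s⁻⁴ − s⁻⁷)`, `W″(s) = ½(7s⁻⁸ − 4s⁻⁵)` and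
`W‴(s) = 10s⁻⁶ − 28s⁻⁹ = s⁻⁹(10s³ − 28) ≥ 0` for `s³ ≥ 14/5`; since `(71/50)³ > 14/5`, `W″` is
nondecreasing on `[71/50, ∞)` (`cable_W2_monotoneOn`). Hence for `t ≥ 71/50` and `sr, s ≥ t` the
second-order Taylor remainder of `W` at `sr` is at least `½ W″(t) (s − sr)²`:
`W(sr) + W′(sr)(s − sr) − ¼(4t⁻⁵ − 7t⁻⁸)(s − sr)² ≤ W(s)` (`tube_cableLowerModel`). The Taylor step
is the elementary `cable_taylorLowerBound`: if `f″ ≥ c` on `[t, ∞)` then the remainder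
`φ(u) = f(u) − f(sr) − f′(sr)(u − sr) − (c/2)(u − sr)²` has a derivative that is monotone on
`[t, ∞)` and vanishes at `sr`, so `φ` decreases on `[t, sr]`, increases on `[sr, ∞)`, and
`φ ≥ φ(sr) = 0` (three applications of the first-derivative monotonicity test). All `[folklore]`.
-/

noncomputable section

namespace Summit.AtomisticToContinuum.Crystallization.Theorems.PalmUnimodularRigidity.LayeredLawsSelectHcp

open Set
open Literature.MathematicalPhysics.StatisticalMechanics

/-! ## A second-order Taylor lower bound from a lower bound on `f″` -/

/-- If `f′ = f'`, `f'′ = f''` and `c ≤ f''` on `[t, ∞)`, then for `sr, s ≥ t`,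
`f sr + f' sr (s − sr) + (c/2)(s − sr)² ≤ f s`. [folklore] -/
theorem cable_taylorLowerBound {f f' f'' : ℝ → ℝ} {t c : ℝ}
    (hf : ∀ u, t ≤ u → HasDerivAt f (f' u) u) (hf' : ∀ u, t ≤ u → HasDerivAt f' (f'' u) u)
    (hc : ∀ u, t ≤ u → c ≤ f'' u) {sr s : ℝ} (hsr : t ≤ sr) (hs : t ≤ s) :
    f sr + f' sr * (s - sr) + c / 2 * (s - sr) ^ 2 ≤ f s := by
  -- the derivative `ψ` of the remainder `φ`, and `φ` itself
  have hψ : ∀ u, t ≤ u →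
      HasDerivAt (fun u => f' u - f' sr - c * (u - sr)) (f'' u - c) u := by
    intro u hu
    have h := ((hf' u hu).sub_const (f' sr)).fun_sub
      (((hasDerivAt_id' u).sub_const sr).const_mul c)
    exact h.congr_deriv (by ring)
  have hφ : ∀ u, t ≤ u →
      HasDerivAt (fun u => f u - f sr - f' sr * (u - sr) - c / 2 * (u - sr) ^ 2)
        (f' u - f' sr - c * (u - sr)) u := by
    intro u hu
    have h2 : HasDerivAt (fun u : ℝ => (u - sr) ^ 2) (2 * (u - sr)) u := by
      simpa using ((hasDerivAt_id' u).sub_const sr).fun_pow 2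
    have h := (((hf u hu).sub_const (f sr)).fun_sub
      (((hasDerivAt_id' u).sub_const sr).const_mul (f' sr))).fun_sub (h2.const_mul (c / 2))
    exact h.congr_deriv (by ring)
  -- `ψ` is monotone on `[t, ∞)` (its derivative `f'' - c` is nonnegative there) and `ψ sr = 0`
  have hψmono : MonotoneOn (fun u => f' u - f' sr - c * (u - sr)) (Ici t) := by
    refine monotoneOn_of_hasDerivWithinAt_nonneg (convex_Ici t)
      (fun u hu => (hψ u (mem_Ici.1 hu)).continuousAt.continuousWithinAt)
      (fun u hu => (hψ u (mem_Ici.1 (interior_subset hu))).hasDerivWithinAt) ?_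
    intro u hu
    exact sub_nonneg.2 (hc u (mem_Ici.1 (interior_subset hu)))
  have e0 : f' sr - f' sr - c * (sr - sr) = 0 := by ring
  have e1 : f sr - f sr - f' sr * (sr - sr) - c / 2 * (sr - sr) ^ 2 = 0 := by ring
  rcases le_total sr s with hle | hle
  · -- on `[sr, ∞)` the remainder is nondecreasing
    have hmono : MonotoneOn (fun u => f u - f sr - f' sr * (u - sr) - c / 2 * (u - sr) ^ 2)
        (Ici sr) := by
      refine monotoneOn_of_hasDerivWithinAt_nonneg (convex_Ici sr)
        (fun u hu => (hφ u (hsr.trans (mem_Ici.1 hu))).continuousAt.continuousWithinAt)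
        (fun u hu => (hφ u (hsr.trans (mem_Ici.1 (interior_subset hu)))).hasDerivWithinAt) ?_
      intro u hu
      have hu' : sr ≤ u := mem_Ici.1 (interior_subset hu)
      have key : f' sr - f' sr - c * (sr - sr) ≤ f' u - f' sr - c * (u - sr) :=
        hψmono (mem_Ici.2 hsr) (mem_Ici.2 (hsr.trans hu')) hu'
      show 0 ≤ f' u - f' sr - c * (u - sr)
      linarith [key, e0]
    have key : f sr - f sr - f' sr * (sr - sr) - c / 2 * (sr - sr) ^ 2 ≤
        f s - f sr - f' sr * (s - sr) - c / 2 * (s - sr) ^ 2 :=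
      hmono self_mem_Ici (mem_Ici.2 hle) hle
    linarith [key, e1]
  · -- on `[t, sr]` the remainder is nonincreasing
    have hanti : AntitoneOn (fun u => f u - f sr - f' sr * (u - sr) - c / 2 * (u - sr) ^ 2)
        (Icc t sr) := by
      refine antitoneOn_of_hasDerivWithinAt_nonpos (convex_Icc t sr)
        (fun u hu => (hφ u (mem_Icc.1 hu).1).continuousAt.continuousWithinAt)
        (fun u hu => (hφ u (mem_Icc.1 (interior_subset hu)).1).hasDerivWithinAt) ?_
      intro u hu
      have hu' : t ≤ u ∧ u ≤ sr := mem_Icc.1 (interior_subset hu)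
      have key : f' u - f' sr - c * (u - sr) ≤ f' sr - f' sr - c * (sr - sr) :=
        hψmono (mem_Ici.2 hu'.1) (mem_Ici.2 hsr) hu'.2
      show f' u - f' sr - c * (u - sr) ≤ 0
      linarith [key, e0]
    have key : f sr - f sr - f' sr * (sr - sr) - c / 2 * (sr - sr) ^ 2 ≤
        f s - f sr - f' sr * (s - sr) - c / 2 * (s - sr) ^ 2 :=
      hanti (mem_Icc.2 ⟨hs, hle⟩) (mem_Icc.2 ⟨hsr, le_rfl⟩) hle
    linarith [key, e1]

/-! ## The well `W(s) = V_LJ(√s)` and its first three derivatives -/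

/-- `d/du (u⁻¹)ⁿ = −n (u⁻¹)ⁿ⁺¹` at `u ≠ 0`. [folklore] -/
theorem cable_hasDerivAt_inv_pow {u : ℝ} (hu : u ≠ 0) (n : ℕ) :
    HasDerivAt (fun y : ℝ => y⁻¹ ^ n) (-(n : ℝ) * u⁻¹ ^ (n + 1)) u := by
  rcases n with _ | k
  · simpa using hasDerivAt_const u (1 : ℝ)
  · have h := (hasDerivAt_inv hu).fun_pow (k + 1)
    rw [Nat.add_sub_cancel] at h
    refine h.congr_deriv ?_
    push_cast
    ring

/-- `W(s) = V_LJ(√s) = s⁻⁶/12 − s⁻³/6` for `s ≥ 0`. [folklore] -/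
theorem cable_lennardJones_sqrt {s : ℝ} (hs : 0 ≤ s) :
    lennardJones (Real.sqrt s) = 1 / 12 * s⁻¹ ^ 6 - 1 / 6 * s⁻¹ ^ 3 := by
  obtain ⟨r, hr0, rfl⟩ : ∃ r : ℝ, 0 ≤ r ∧ r ^ 2 = s :=
    ⟨Real.sqrt s, Real.sqrt_nonneg s, Real.sq_sqrt hs⟩
  rw [Real.sqrt_sq hr0]
  unfold lennardJones
  ring

/-- `W′ = ½(s⁻⁴ − s⁻⁷)` (`= ljSqDeriv`) at `s ≠ 0`. [folklore] -/
theorem cable_hasDerivAt_W {u : ℝ} (hu : u ≠ 0) :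
    HasDerivAt (fun s : ℝ => 1 / 12 * s⁻¹ ^ 6 - 1 / 6 * s⁻¹ ^ 3)
      (1 / 2 * (u⁻¹ ^ 4 - u⁻¹ ^ 7)) u := by
  have h := ((cable_hasDerivAt_inv_pow hu 6).const_mul (1 / 12 : ℝ)).fun_sub
    ((cable_hasDerivAt_inv_pow hu 3).const_mul (1 / 6 : ℝ))
  refine h.congr_deriv ?_
  push_cast
  ring

/-- `W″ = ½(7s⁻⁸ − 4s⁻⁵)` at `s ≠ 0`. [folklore] -/
theorem cable_hasDerivAt_W1 {u : ℝ} (hu : u ≠ 0) :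
    HasDerivAt (fun s : ℝ => 1 / 2 * (s⁻¹ ^ 4 - s⁻¹ ^ 7))
      (1 / 2 * (7 * u⁻¹ ^ 8 - 4 * u⁻¹ ^ 5)) u := by
  have h := ((cable_hasDerivAt_inv_pow hu 4).fun_sub (cable_hasDerivAt_inv_pow hu 7)).const_mul
    (1 / 2 : ℝ)
  refine h.congr_deriv ?_
  push_cast
  ring

/-- `W‴ = 10s⁻⁶ − 28s⁻⁹` at `s ≠ 0`. [folklore] -/
theorem cable_hasDerivAt_W2 {u : ℝ} (hu : u ≠ 0) :
    HasDerivAt (fun s : ℝ => 1 / 2 * (7 * s⁻¹ ^ 8 - 4 * s⁻¹ ^ 5))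
      (10 * u⁻¹ ^ 6 - 28 * u⁻¹ ^ 9) u := by
  have h := (((cable_hasDerivAt_inv_pow hu 8).const_mul (7 : ℝ)).fun_sub
    ((cable_hasDerivAt_inv_pow hu 5).const_mul (4 : ℝ))).const_mul (1 / 2 : ℝ)
  refine h.congr_deriv ?_
  push_cast
  ring

/-- `W″` is nondecreasing on `[71/50, ∞)`: there `W‴(s) = s⁻⁹(10s³ − 28) ≥ 0` as
`(50/71)³ = 125000/357911 ≤ 5/14`. [folklore] -/
theorem cable_W2_monotoneOn :
    MonotoneOn (fun s : ℝ => 1 / 2 * (7 * s⁻¹ ^ 8 - 4 * s⁻¹ ^ 5)) (Ici (71 / 50)) := by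
  have hne : ∀ u ∈ Ici (71 / 50 : ℝ), u ≠ 0 := fun u hu =>
    ((mem_Ici.1 hu).trans_lt' (by norm_num)).ne'
  refine monotoneOn_of_hasDerivWithinAt_nonneg (convex_Ici _)
    (fun u hu => (cable_hasDerivAt_W2 (hne u hu)).continuousAt.continuousWithinAt)
    (fun u hu => (cable_hasDerivAt_W2 (hne u (interior_subset hu))).hasDerivWithinAt) ?_
  intro u hu
  have hu' : (71 / 50 : ℝ) ≤ u := mem_Ici.1 (interior_subset hu)
  have h0 : 0 < u := hu'.trans_lt' (by norm_num)
  have hx : u⁻¹ ≤ 50 / 71 := by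
    rw [show (50 / 71 : ℝ) = (71 / 50)⁻¹ by norm_num]
    exact inv_anti₀ (by norm_num) hu'
  have hx0 : 0 ≤ u⁻¹ := inv_nonneg.2 h0.le
  have hx3 : u⁻¹ ^ 3 ≤ 125000 / 357911 :=
    calc u⁻¹ ^ 3 ≤ (50 / 71) ^ 3 := pow_le_pow_left₀ hx0 hx 3
      _ = 125000 / 357911 := by norm_num
  have h6 : 0 ≤ u⁻¹ ^ 6 := pow_nonneg hx0 6
  calc (0 : ℝ) ≤ u⁻¹ ^ 6 * (10 - 28 * u⁻¹ ^ 3) := mul_nonneg h6 (by linarith)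
    _ = 10 * u⁻¹ ^ 6 - 28 * u⁻¹ ^ 9 := by ring

/-! ## The stub -/

/-- **Cable lower model (stub `tube_cableLowerModel`).** For `t ≥ 71/50` and `sr, s ≥ t`:
`W(sr) + W′(sr)(s − sr) − ¼(4t⁻⁵ − 7t⁻⁸)(s − sr)² ≤ W(s)`, `W(s) = V_LJ(√s)`, `W′ = ljSqDeriv`
(the concave cable well lies above the quadratic model whose curvature is the worst `W″` on
`[t, ∞)`, namely `W″(t) = −½(4t⁻⁵ − 7t⁻⁸)`). [folklore] -/
theorem tube_cableLowerModel : ∀ sr t s : ℝ, 71 / 50 ≤ t → t ≤ sr → t ≤ s →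
    lennardJones (Real.sqrt sr) + ljSqDeriv sr * (s - sr)
      - 1 / 4 * (4 * (t⁻¹) ^ 5 - 7 * (t⁻¹) ^ 8) * (s - sr) ^ 2 ≤ lennardJones (Real.sqrt s) := by
  intro sr t s ht hsr hs
  have ht0 : 0 < t := ht.trans_lt' (by norm_num)
  rw [cable_lennardJones_sqrt (ht0.le.trans hsr), cable_lennardJones_sqrt (ht0.le.trans hs)]
  have key := cable_taylorLowerBound (f := fun u : ℝ => 1 / 12 * u⁻¹ ^ 6 - 1 / 6 * u⁻¹ ^ 3)
    (f' := fun u : ℝ => 1 / 2 * (u⁻¹ ^ 4 - u⁻¹ ^ 7))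
    (f'' := fun u : ℝ => 1 / 2 * (7 * u⁻¹ ^ 8 - 4 * u⁻¹ ^ 5)) (t := t)
    (c := 1 / 2 * (7 * t⁻¹ ^ 8 - 4 * t⁻¹ ^ 5))
    (fun u hu => cable_hasDerivAt_W (ht0.trans_le hu).ne')
    (fun u hu => cable_hasDerivAt_W1 (ht0.trans_le hu).ne')
    (fun u hu => cable_W2_monotoneOn (mem_Ici.2 ht) (mem_Ici.2 (ht.trans hu)) hu)
    hsr hs
  beta_reduce at key
  unfold ljSqDeriv
  convert key using 1
  ring

end Summit.AtomisticToContinuum.Crystallization.Theorems.PalmUnimodularRigidity.LayeredLawsSelectHcp
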